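import Mathlib
import Summits.QuantumFields.YangMills.Theorems.BalabanUVNodesN15BackgroundPairEntries
import HarnessLib

/-!
# Route «BalabanUVNodes» (cluster K4 «SpineRates»), Track-A DAG node N15 = spine estimate NE2, BACKGROUND LAYER — `T4EtaRate.NE2PlusOperator` BY NAME FOR
# THE FIRST-ORDER SPECIES WITH ALL FOUR (3.42) ENTRIES OF THE BACKGROUND-DEPENDENT PAIR CONSTRUCTED, ONLY the `U ≡ 1` layer displayed

Cell `pub-ymgap`, seat `pub-ymgap-dag-n15-b` (generation g5; FIRST-MISSING-ESTIMATE, HUMAN RULING D-0062; chair R424 venue; ROSTER-D0062 l.26).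
`bears_on: R4∕N15`.  Filed `--supports stmt-QuantumFields-19676` (K3 `SpineGivenEndpointR11`; helper).  Imports parts B1–B3 `…N15.BackgroundLayer` (`bgPair`,
`bgSourceV`, `bgDerivedV`, `stack`, `unstack`, `coeffBg₁`, `avg₁`, `bgInstance₁`, `hasMaj_entry01_background₁`, `hasMaj_idef_bgSourceV`, `hasMaj_idef_bgDerivedV`,
`poly0_le`, `bgConst`, `bgConst1`) and g0's `…N15.OperatorReadout` BY NAME; nothing in the tree is modified.

THE POINT.  Part B2 read out the first-order species with entries 2∕3 displayed; part B3 constructed them over the stacked space.  Here: the guard-level bounds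
of entries 2∕3 with the letters READ OFF `coeffBg₁`'s `Reg335` (`unstack_letters_of_reg335`), the four entry operators `bgOps₁4` — `𝔇(X′, X)`,
`𝔇(∇′_νX′, ∇_νX)` (components of `bgPair`), `𝔇(Z′, Z)` (`bgSourceV` over the stacks, source stack `(G∇*, (∇_μG∇*)_μ)` — the (3.44)-shaped pieces), `𝔇(Y₃′, Y₃)`
(`bgDerivedV`, piece `ΔG`) — the per-index `EtaRateIneq342` with explicit constants, and `NE2PlusOperator` BY NAME for any family whose ONLY displayed hypotheses
are the NE2⁰ operator layer of the `U ≡ 1` pieces: uniform majorants `β·e^{−δd}` of `G, ∇_μG, G∇*, ∇_μG∇*, Δ′G′` (coarse∕fine as used) and the η-defects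
`m₀·θ·e^{−δd}` of the five pairs `(G′,G), (∇′_μG′,∇_μG), (G′∇′*,G∇*), (∇′_μG′∇′*,∇_μG∇*), (Δ′G′,ΔG)` — (3.35) CONSUMED on every coefficient of
`V = M_c + Σ_μ M_{a_μ}∘∇_μ`.

THE PRINT (SHAPES and quantifier template only; nothing of [B9] asserted).  [Balaban1985BackgroundPropagators] Thm 3.1 (3.42) + (3.44) p. 397, (3.35) p. 396,
(3.52) p. 400, (3.63)–(3.65) pp. 402–403; [King1986] Prop. 3.9 (3.73) p. 665 (separate derivative kernels: shape).

CONTENTS ([folklore] bookkeeping; 2 defs).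
* §1 `unstack_letters_of_reg335`; **`hasMaj_entry2_background₁`** (`≤ bgConst(β, c_r, m₀, c₃₅(1+|J|), a₀)·θ·e^{−(δ−σ)d}`), **`hasMaj_entry3_background₁`**
  (`≤ bgConst1(…)·θ·e^{−(δ−σ)d}`).
* §2 `bgOps₁4` (ALL FOUR ENTRIES of the first-order pair CONSTRUCTED), `bgFamily₁4`, **`etaRateIneq342_background₁4`** (per index, `B₀ = bgConst(…) + bgConst1(…)`,
  `δ₀ = δ − σ`), **`ne2PlusOperator_background₁4`** (`M₅ := 1`, `a₀ := (2c₃₅(1+|J|)(βc_r+1))⁻¹`, `B₀ + 1`).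

HONEST FRAMING ∕ LIMITS.  As parts B1–B3: bookkeeping + linear algebra over hypothesis-shaped data; the `U ≡ 1` layer DISPLAYED (the mixed piece `∇_μG∇*` and
its two-lattice rate are NOT in the tree on the unit torus — located); scalar coefficients, linearised transport, sites of size `≥ 1`; the guard reads the
datum's `M` (by-name statement live iff the family has unbounded `M`; §2 per index is the unconditional content); nothing about Bałaban's `G(U)` asserted.
NE2⁺ NOT PRINTED, NOT proved; count-neutral (typed 28∕28; nothing discharged); N15 NOT discharged; one finite lattice at fixed ε — NOT infinite volume, NOT OS
on ℝ⁴, NOT a mass gap, NOT Clay.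
-/

noncomputable section

namespace Summit.QuantumFields.YangMills.BalabanUVNodes.N15.BackgroundLayer

open Literature.MathematicalPhysics.QuantumFieldTheory.Balaban1983to89
open Literature.MathematicalPhysics.QuantumFieldTheory.Balaban1983to89.B11SectG (BlockNorm HasMaj RowSum)
open Literature.MathematicalPhysics.QuantumFieldTheory.Balaban1983to89.T4EtaRate (PairedInstance EtaRateIneq342 NE2PlusOperator rateFactor)
open Literature.MathematicalPhysics.QuantumFieldTheory.Balaban1983to89.T4EtaRateDefect (idef rateWeight)
open Literature.MathematicalPhysics.QuantumFieldTheory.Balaban1983to89.T4EtaRateCoeffDefect (pull diagK FibreOsc blockAvg fit_blockAvg)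
open Literature.MathematicalPhysics.QuantumFieldTheory.Balaban1983to89.B6RandomWalk (Triangle254)
open Literature.MathematicalPhysics.QuantumFieldTheory.Balaban1983to89.B9SectDSup (inv_one_sub_le_two)
open Summit.QuantumFields.YangMills.BalabanUVNodes.N15.OperatorReadout (opGeo opFamily opGeo_len rateFactor_opGeo etaRateIneq342_of_hasMaj)

/-! ## §1 The first-order pair under the guard: letters read off `Reg335`, entries 2 and 3 -/

section Guard

variable {X X' J : Type} [Fintype X] [Fintype X'] [Fintype J] [DecidableEq X] [DecidableEq X'] [DecidableEq J] {g : B6.Geometry}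
  (blk : X → g.Site) (π : X' → X)
variable {G S D₃ : (X → ℝ) →ₗ[ℝ] (X → ℝ)} {D SD : J → (X → ℝ) →ₗ[ℝ] (X → ℝ)} {G' S' D₃' : (X' → ℝ) →ₗ[ℝ] (X' → ℝ)}
  {D' SD' : J → (X' → ℝ) →ₗ[ℝ] (X' → ℝ)}

omit [DecidableEq X'] [DecidableEq J] in
/-- The letters of a `Reg335`-regular coefficient family under the guard: sup `r = c₃₅Mα₀`, stacked bound `R = r(1+|J|) ≤ c₃₅(1+|J|)a₀`, contraction `q ≤ ½`,
and the majorants∕defect of the unstacked perturbations at both spacings. [cite: Balaban1985BackgroundPropagators, Thm 3.1 p.397 (quantifier template); (3.35) p.396 (shape)] -/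
theorem unstack_letters_of_reg335 {β cr θ c35 a₀ M α₀ : ℝ} (hcr : 0 ≤ cr) (hβ : 0 ≤ β) (hθ : 0 ≤ θ) (hc35 : 0 < c35)
    (hq : β * (c35 * (1 + Fintype.card J) * a₀) * cr ≤ 1 / 2) (hM : 1 ≤ M) (hMα : M * α₀ ≤ a₀) (hα₀ : 0 < α₀)
    {U : (X' → ℝ) × (J → X' → ℝ)} (hreg : (coeffBg₁ J π M θ).Reg335 c35 α₀ U) :
    0 ≤ c35 * M * α₀ * (1 + Fintype.card J) ∧ c35 * M * α₀ * (1 + Fintype.card J) ≤ c35 * (1 + Fintype.card J) * a₀ ∧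
      β * (c35 * M * α₀ * (1 + Fintype.card J)) * cr < 1 ∧ (1 - β * (c35 * M * α₀ * (1 + Fintype.card J)) * cr)⁻¹ ≤ 2 ∧
      HasMaj (BlockNorm.ofBlocks g (blkPair blk)) (BlockNorm.ofBlocks g blk) (unstack (avg₁ J π U).1 (avg₁ J π U).2)
        (diagK fun _ => c35 * M * α₀ * (1 + Fintype.card J)) ∧
      HasMaj (BlockNorm.ofBlocks g (blkPair (blk ∘ π))) (BlockNorm.ofBlocks g (blk ∘ π)) (unstack U.1 U.2)
        (diagK fun _ => c35 * M * α₀ * (1 + Fintype.card J)) ∧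
      HasMaj (BlockNorm.ofBlocks g (blkPair blk)) (BlockNorm.ofBlocks g (blk ∘ π))
        (idef (pull (liftPair π)) (pull π) (unstack U.1 U.2) (unstack (avg₁ J π U).1 (avg₁ J π U).2))
        (diagK fun _ => c35 * M * α₀ * θ * (1 + Fintype.card J)) := by
  obtain ⟨⟨hsc, hsa⟩, hoc, hoa⟩ := (reg335_coeffBg₁_iff J π M θ c35 α₀ U).1 hreg
  set r : ℝ := c35 * M * α₀ with hr_def
  have hJ0 : (0 : ℝ) ≤ 1 + Fintype.card J := by positivity
  have hM0 : 0 ≤ M := zero_le_one.trans hM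
  have hr0 : 0 ≤ r := by positivity
  have hra : r ≤ c35 * a₀ := by rw [hr_def, mul_assoc]; exact mul_le_mul_of_nonneg_left hMα hc35.le
  have hRa : r * (1 + Fintype.card J) ≤ c35 * (1 + Fintype.card J) * a₀ := by
    calc r * (1 + Fintype.card J) ≤ c35 * a₀ * (1 + Fintype.card J) := mul_le_mul_of_nonneg_right hra hJ0
      _ = c35 * (1 + Fintype.card J) * a₀ := by ring
  have hq' : β * (r * (1 + Fintype.card J)) * cr ≤ 1 / 2 := (mul_le_mul_of_nonneg_right (mul_le_mul_of_nonneg_left hRa hβ) hcr).trans hq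
  have hc : ∀ x, |(avg₁ J π U).1 x| ≤ r := abs_blockAvg_le π hr0 hsc
  have ha : ∀ μ x, |(avg₁ J π U).2 μ x| ≤ r := fun μ => abs_blockAvg_le π hr0 (hsa μ)
  have hfc : ∀ x', |U.1 x' - (avg₁ J π U).1 (π x')| ≤ r * θ := fun x' => fit_blockAvg π hoc x'
  have hfa : ∀ μ x', |U.2 μ x' - (avg₁ J π U).2 μ (π x')| ≤ r * θ := fun μ x' => fit_blockAvg π (hoa μ) x'
  exact ⟨mul_nonneg hr0 hJ0, hRa, by linarith, inv_one_sub_le_two hq', hasMaj_unstack blk hr0 hc ha, hasMaj_unstack (blk ∘ π) hr0 hsc hsa,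
    hasMaj_idef_unstack blk π (mul_nonneg hr0 hθ) hfc hfa⟩

/-- **ENTRY 2 OF THE FIRST-ORDER PAIR UNDER THE GUARD**: with the `U ≡ 1` source stack `Ŝ = stack S SD` (`S = G∇*`, `SD_μ = ∇_μG∇*` — the (3.44)-shaped pieces),
majorants `β·e^{−δd}` and defects `m₀·θ·e^{−δd}`: `𝔇(Z′(U), Z(Ū)) ≤ bgConst(β, c_r, m₀, c₃₅(1+|J|), a₀)·θ·e^{−(δ−σ)d}` for every regular `U` under the guard.
[cite: Balaban1985BackgroundPropagators, Thm 3.1 (3.42)₃ + (3.44) p.397 (shapes); (3.63)–(3.65) pp.402–403 (mechanism)] -/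
theorem hasMaj_entry2_background₁ (htri : Triangle254 g) (hd : ∀ a b : g.Site, 0 ≤ g.dist a b) {σ cr : ℝ} (hσ : 0 ≤ σ) (hcr : 0 ≤ cr)
    (hrow : RowSum g σ cr) {δ β m₀ θ c35 a₀ M α₀ : ℝ} (hσδ : σ ≤ δ) (hβ : 0 ≤ β) (hm₀ : 0 ≤ m₀) (hθ : 0 ≤ θ) (hc35 : 0 < c35)
    (hq : β * (c35 * (1 + Fintype.card J) * a₀) * cr ≤ 1 / 2) (hM : 1 ≤ M) (hα₀ : 0 < α₀) (hMα : M * α₀ ≤ a₀)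
    (hG : HasMaj (BlockNorm.ofBlocks g blk) (BlockNorm.ofBlocks g blk) G (fun y y' => β * Real.exp (-(δ * g.dist y y'))))
    (hD : ∀ μ, HasMaj (BlockNorm.ofBlocks g blk) (BlockNorm.ofBlocks g blk) (D μ) (fun y y' => β * Real.exp (-(δ * g.dist y y'))))
    (hG' : HasMaj (BlockNorm.ofBlocks g (blk ∘ π)) (BlockNorm.ofBlocks g (blk ∘ π)) G' (fun y y' => β * Real.exp (-(δ * g.dist y y'))))
    (hD' : ∀ μ, HasMaj (BlockNorm.ofBlocks g (blk ∘ π)) (BlockNorm.ofBlocks g (blk ∘ π)) (D' μ) (fun y y' => β * Real.exp (-(δ * g.dist y y'))))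
    (hS : HasMaj (BlockNorm.ofBlocks g blk) (BlockNorm.ofBlocks g blk) S (fun y y' => β * Real.exp (-(δ * g.dist y y'))))
    (hSD : ∀ μ, HasMaj (BlockNorm.ofBlocks g blk) (BlockNorm.ofBlocks g blk) (SD μ) (fun y y' => β * Real.exp (-(δ * g.dist y y'))))
    (hDG : HasMaj (BlockNorm.ofBlocks g blk) (BlockNorm.ofBlocks g (blk ∘ π)) (idef (pull π) (pull π) G' G)
      (fun y y' => m₀ * θ * Real.exp (-(δ * g.dist y y'))))
    (hDD : ∀ μ, HasMaj (BlockNorm.ofBlocks g blk) (BlockNorm.ofBlocks g (blk ∘ π)) (idef (pull π) (pull π) (D' μ) (D μ))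
      (fun y y' => m₀ * θ * Real.exp (-(δ * g.dist y y'))))
    (hDS : HasMaj (BlockNorm.ofBlocks g blk) (BlockNorm.ofBlocks g (blk ∘ π)) (idef (pull π) (pull π) S' S)
      (fun y y' => m₀ * θ * Real.exp (-(δ * g.dist y y'))))
    (hDSD : ∀ μ, HasMaj (BlockNorm.ofBlocks g blk) (BlockNorm.ofBlocks g (blk ∘ π)) (idef (pull π) (pull π) (SD' μ) (SD μ))
      (fun y y' => m₀ * θ * Real.exp (-(δ * g.dist y y'))))
    {U : (X' → ℝ) × (J → X' → ℝ)} (hreg : (coeffBg₁ J π M θ).Reg335 c35 α₀ U) :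
    HasMaj (BlockNorm.ofBlocks g blk) (BlockNorm.ofBlocks g (blkPair (blk ∘ π)))
      (idef (pull π) (pull (liftPair π)) (bgSourceV (stack G' D') (stack S' SD') (unstack U.1 U.2))
        (bgSourceV (stack G D) (stack S SD) (unstack (avg₁ J π U).1 (avg₁ J π U).2)))
      (fun y y' => bgConst β cr m₀ (c35 * (1 + Fintype.card J)) a₀ * θ * Real.exp (-((δ - σ) * g.dist y y'))) := by
  obtain ⟨hR0, hRa, hq1, hinv, hV, hV', hDV⟩ := unstack_letters_of_reg335 (g := g) blk π hcr hβ hθ hc35 hq hM hMα hα₀ hreg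
  have hinv0 : 0 ≤ (1 - β * (c35 * M * α₀ * (1 + Fintype.card J)) * cr)⁻¹ := inv_nonneg.2 (by linarith)
  have hβe : ∀ y y' : g.Site, 0 ≤ β * Real.exp (-(δ * g.dist y y')) := fun _ _ => mul_nonneg hβ (Real.exp_nonneg _)
  have hme : ∀ y y' : g.Site, 0 ≤ m₀ * θ * Real.exp (-(δ * g.dist y y')) := fun _ _ => mul_nonneg (mul_nonneg hm₀ hθ) (Real.exp_nonneg _)
  have hSG := hasMaj_stack blk hβe hG hD
  have hSG' := hasMaj_stack (blk ∘ π) hβe hG' hD'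
  have hSS := hasMaj_stack blk hβe hS hSD
  have hSDG : HasMaj (BlockNorm.ofBlocks g blk) (BlockNorm.ofBlocks g (blkPair (blk ∘ π)))
      (idef (pull π) (pull (liftPair π)) (stack G' D') (stack G D)) (fun y y' => m₀ * θ * Real.exp (-(δ * g.dist y y'))) := by
    rw [idef_stack]; exact hasMaj_stack (blk ∘ π) hme hDG hDD
  have hSDS : HasMaj (BlockNorm.ofBlocks g blk) (BlockNorm.ofBlocks g (blkPair (blk ∘ π)))
      (idef (pull π) (pull (liftPair π)) (stack S' SD') (stack S SD)) (fun y y' => m₀ * θ * Real.exp (-(δ * g.dist y y'))) := by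
    rw [idef_stack]; exact hasMaj_stack (blk ∘ π) hme hDS hDSD
  have hθ' : 0 ≤ c35 * M * α₀ * θ * (1 + Fintype.card J) := by
    have : 0 ≤ c35 * M * α₀ * (1 + Fintype.card J) := hR0
    nlinarith
  have key := hasMaj_idef_bgSourceV blk (blkPair blk) π (liftPair π) htri hd hσ hcr hrow (ρ := δ - σ) (by linarith) (by linarith) hβ hR0 hθ'
    (mul_nonneg hm₀ hθ) (mul_nonneg hm₀ hθ) hSG hSG' hSS hSDG hSDS hV hV' hDV hq1
  refine key.mono fun a b => ?_
  simp only [one_mul, mul_one]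
  refine mul_le_mul_of_nonneg_right ?_ (Real.exp_nonneg _)
  have hpoly := poly0_le (β := β) (cr := cr) (m₀ := m₀) (θ := θ) (c35 := c35 * (1 + Fintype.card J)) (a₀ := a₀)
    (r := c35 * M * α₀ * (1 + Fintype.card J)) (u := (1 - β * (c35 * M * α₀ * (1 + Fintype.card J)) * cr)⁻¹) hβ hcr hm₀ hθ hR0 hRa hinv0 hinv
  have heq : c35 * M * α₀ * θ * (1 + Fintype.card J) = c35 * M * α₀ * (1 + Fintype.card J) * θ := by ring
  rw [heq]
  exact hpoly

/-- **ENTRY 3 OF THE FIRST-ORDER PAIR UNDER THE GUARD**: with the `U ≡ 1` derived pair `D₃, D₃′` (`ΔG`), `D₃′ ≤ β·e^{−δd}`, `𝔇(D₃′, D₃) ≤ m₀·θ·e^{−δd}`: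
`𝔇(bgDerivedV Ĝ′ D₃′ V̂′(U), bgDerivedV Ĝ D₃ V̂(Ū)) ≤ bgConst1(β, c_r, m₀, c₃₅(1+|J|), a₀)·θ·e^{−(δ−σ)d}` for every regular `U` under the guard.
[cite: Balaban1985BackgroundPropagators, Thm 3.1 (3.42)₄ p.397 (shape); King1986, Prop. 3.9 (3.73) p.665 (shape)] -/
theorem hasMaj_entry3_background₁ (htri : Triangle254 g) (hd : ∀ a b : g.Site, 0 ≤ g.dist a b) {σ cr : ℝ} (hσ : 0 ≤ σ) (hcr : 0 ≤ cr)
    (hrow : RowSum g σ cr) {δ β m₀ θ c35 a₀ M α₀ : ℝ} (hσδ : σ ≤ δ) (hβ : 0 ≤ β) (hm₀ : 0 ≤ m₀) (hθ : 0 ≤ θ) (hc35 : 0 < c35) (ha₀ : 0 ≤ a₀)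
    (hq : β * (c35 * (1 + Fintype.card J) * a₀) * cr ≤ 1 / 2) (hM : 1 ≤ M) (hα₀ : 0 < α₀) (hMα : M * α₀ ≤ a₀)
    (hG : HasMaj (BlockNorm.ofBlocks g blk) (BlockNorm.ofBlocks g blk) G (fun y y' => β * Real.exp (-(δ * g.dist y y'))))
    (hD : ∀ μ, HasMaj (BlockNorm.ofBlocks g blk) (BlockNorm.ofBlocks g blk) (D μ) (fun y y' => β * Real.exp (-(δ * g.dist y y'))))
    (hG' : HasMaj (BlockNorm.ofBlocks g (blk ∘ π)) (BlockNorm.ofBlocks g (blk ∘ π)) G' (fun y y' => β * Real.exp (-(δ * g.dist y y'))))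
    (hD' : ∀ μ, HasMaj (BlockNorm.ofBlocks g (blk ∘ π)) (BlockNorm.ofBlocks g (blk ∘ π)) (D' μ) (fun y y' => β * Real.exp (-(δ * g.dist y y'))))
    (hD₃' : HasMaj (BlockNorm.ofBlocks g (blk ∘ π)) (BlockNorm.ofBlocks g (blk ∘ π)) D₃' (fun y y' => β * Real.exp (-(δ * g.dist y y'))))
    (hDG : HasMaj (BlockNorm.ofBlocks g blk) (BlockNorm.ofBlocks g (blk ∘ π)) (idef (pull π) (pull π) G' G)
      (fun y y' => m₀ * θ * Real.exp (-(δ * g.dist y y'))))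
    (hDD : ∀ μ, HasMaj (BlockNorm.ofBlocks g blk) (BlockNorm.ofBlocks g (blk ∘ π)) (idef (pull π) (pull π) (D' μ) (D μ))
      (fun y y' => m₀ * θ * Real.exp (-(δ * g.dist y y'))))
    (hDD₃ : HasMaj (BlockNorm.ofBlocks g blk) (BlockNorm.ofBlocks g (blk ∘ π)) (idef (pull π) (pull π) D₃' D₃)
      (fun y y' => m₀ * θ * Real.exp (-(δ * g.dist y y'))))
    {U : (X' → ℝ) × (J → X' → ℝ)} (hreg : (coeffBg₁ J π M θ).Reg335 c35 α₀ U) :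
    HasMaj (BlockNorm.ofBlocks g blk) (BlockNorm.ofBlocks g (blk ∘ π))
      (idef (pull π) (pull π) (bgDerivedV (stack G' D') D₃' (unstack U.1 U.2))
        (bgDerivedV (stack G D) D₃ (unstack (avg₁ J π U).1 (avg₁ J π U).2)))
      (fun y y' => bgConst1 β cr m₀ (c35 * (1 + Fintype.card J)) a₀ * θ * Real.exp (-((δ - σ) * g.dist y y'))) := by
  obtain ⟨hR0, hRa, hq1, hinv, hV, hV', hDV⟩ := unstack_letters_of_reg335 (g := g) blk π hcr hβ hθ hc35 hq hM hMα hα₀ hreg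
  set R : ℝ := c35 * M * α₀ * (1 + Fintype.card J) with hR_def
  have hq'' : β * R * cr ≤ 1 / 2 := (mul_le_mul_of_nonneg_right (mul_le_mul_of_nonneg_left hRa hβ) hcr).trans hq
  have hinv0 : 0 ≤ (1 - β * R * cr)⁻¹ := inv_nonneg.2 (by linarith)
  have hβe : ∀ y y' : g.Site, 0 ≤ β * Real.exp (-(δ * g.dist y y')) := fun _ _ => mul_nonneg hβ (Real.exp_nonneg _)
  have hme : ∀ y y' : g.Site, 0 ≤ m₀ * θ * Real.exp (-(δ * g.dist y y')) := fun _ _ => mul_nonneg (mul_nonneg hm₀ hθ) (Real.exp_nonneg _)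
  have hSG := hasMaj_stack blk hβe hG hD
  have hSG' := hasMaj_stack (blk ∘ π) hβe hG' hD'
  have hSDG : HasMaj (BlockNorm.ofBlocks g blk) (BlockNorm.ofBlocks g (blkPair (blk ∘ π)))
      (idef (pull π) (pull (liftPair π)) (stack G' D') (stack G D)) (fun y y' => m₀ * θ * Real.exp (-(δ * g.dist y y'))) := by
    rw [idef_stack]; exact hasMaj_stack (blk ∘ π) hme hDG hDD
  have hθ' : 0 ≤ c35 * M * α₀ * θ * (1 + Fintype.card J) := by
    have : 0 ≤ c35 * M * α₀ * (1 + Fintype.card J) := hR0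
    nlinarith
  have key := hasMaj_idef_bgDerivedV blk (blkPair blk) π (liftPair π) htri hd hσ hcr hrow (ρ := δ - σ) (by linarith) (by linarith) hβ hR0 hθ'
    (mul_nonneg hm₀ hθ) (mul_nonneg hm₀ hθ) hSG hSG' hD₃' hSDG hDD₃ hV hV' hDV hq1
  refine key.mono fun a b => ?_
  simp only [one_mul]
  refine mul_le_mul_of_nonneg_right ?_ (Real.exp_nonneg _)
  have heq : c35 * M * α₀ * θ * (1 + Fintype.card J) = R * θ := by rw [hR_def]; ring
  rw [heq]
  set u : ℝ := (1 - β * R * cr)⁻¹ with hu_def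
  have h0 := poly0_le (β := β) (cr := cr) (m₀ := m₀) (θ := θ) (c35 := c35 * (1 + Fintype.card J)) (a₀ := a₀) (r := R) (u := u)
    hβ hcr hm₀ hθ hR0 hRa hinv0 hinv
  have h2 : m₀ * θ * cr * (R * (β * u)) ≤ m₀ * θ * cr * (c35 * (1 + Fintype.card J) * a₀ * (β * 2)) := by gcongr
  have h3 : β * R * cr * ((m₀ * θ * cr + m₀ * θ * cr * (R * (β * u)) + β * (R * θ) * (β * u) * cr) * u) ≤
      1 / 2 * (bgConst β cr m₀ (c35 * (1 + Fintype.card J)) a₀ * θ) := mul_le_mul hq'' h0 (by positivity) (by norm_num)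
  have h4 : β * (R * θ) * (β * u) * cr ≤ β * (c35 * (1 + Fintype.card J) * a₀ * θ) * (β * 2) * cr := by gcongr
  calc m₀ * θ * cr + m₀ * θ * cr * (R * (β * u)) +
        β * R * cr * ((m₀ * θ * cr + m₀ * θ * cr * (R * (β * u)) + β * (R * θ) * (β * u) * cr) * u) + β * (R * θ) * (β * u) * cr
      ≤ m₀ * θ * cr + m₀ * θ * cr * (c35 * (1 + Fintype.card J) * a₀ * (β * 2)) +
        1 / 2 * (bgConst β cr m₀ (c35 * (1 + Fintype.card J)) a₀ * θ) + β * (c35 * (1 + Fintype.card J) * a₀ * θ) * (β * 2) * cr :=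
        add_le_add (add_le_add (add_le_add le_rfl h2) h3) h4
    _ = bgConst1 β cr m₀ (c35 * (1 + Fintype.card J)) a₀ * θ := by unfold bgConst1; ring

end Guard

/-! ## §2 All four entries of the first-order pair: the kernel family, `EtaRateIneq342` per index, `NE2PlusOperator` BY NAME -/

section Readout

variable {X X' J : Type} [Fintype X] [Fintype X'] [Fintype J] [DecidableEq X] [DecidableEq X'] [DecidableEq J] {g : B6.Geometry}
  (blk : X → g.Site) (π : X' → X)

/-- THE FOUR ENTRY OPERATORS OF THE FIRST-ORDER BACKGROUND-DEPENDENT PAIR, ALL CONSTRUCTED: entry 0 ∕ 1 = the `none` ∕ `some ν` components of `bgPair`, entry 2 =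
the source step over the stacks with the source stack `(S, SD_μ)` (= `(G∇*, ∇_μG∇*)`), entry 3 = the derived object of `D₃` (= `ΔG`); coarse coefficients = block
averages. [cite: Balaban1985BackgroundPropagators, (3.42) p.397 (the four entries: shape)] -/
def bgOps₁4 (ν : J) (G S D₃ : (X → ℝ) →ₗ[ℝ] (X → ℝ)) (D SD : J → (X → ℝ) →ₗ[ℝ] (X → ℝ)) (G' S' D₃' : (X' → ℝ) →ₗ[ℝ] (X' → ℝ))
    (D' SD' : J → (X' → ℝ) →ₗ[ℝ] (X' → ℝ)) : Fin 4 → (X' → ℝ) × (J → X' → ℝ) → ((X → ℝ) →ₗ[ℝ] (X' → ℝ)) :=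
  fun n U => ![idef (pull π) (pull π) (projO none ∘ₗ bgPair G' D' U.1 U.2) (projO none ∘ₗ bgPair G D (avg₁ J π U).1 (avg₁ J π U).2),
    idef (pull π) (pull π) (projO (some ν) ∘ₗ bgPair G' D' U.1 U.2) (projO (some ν) ∘ₗ bgPair G D (avg₁ J π U).1 (avg₁ J π U).2),
    idef (pull π) (pull π) (projO none ∘ₗ bgSourceV (stack G' D') (stack S' SD') (unstack U.1 U.2))
      (projO none ∘ₗ bgSourceV (stack G D) (stack S SD) (unstack (avg₁ J π U).1 (avg₁ J π U).2)),
    idef (pull π) (pull π) (bgDerivedV (stack G' D') D₃' (unstack U.1 U.2)) (bgDerivedV (stack G D) D₃ (unstack (avg₁ J π U).1 (avg₁ J π U).2))] n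

/-- THE KERNEL FAMILY over the first-order carrier with all four entries constructed. [cite: Balaban1985BackgroundPropagators, (3.42) p.397 (shape)] -/
def bgFamily₁4 (n : ℕ) (hL : g.L ≠ 0) (θc θ : ℝ) (ν : J) (G S D₃ : (X → ℝ) →ₗ[ℝ] (X → ℝ)) (D SD : J → (X → ℝ) →ₗ[ℝ] (X → ℝ))
    (G' S' D₃' : (X' → ℝ) →ₗ[ℝ] (X' → ℝ)) (D' SD' : J → (X' → ℝ) →ₗ[ℝ] (X' → ℝ)) :
    B9.KernelFamily (bgInstance₁ J blk π n hL θc θ).gc (bgInstance₁ J blk π n hL θc θ).Bf :=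
  show B9.KernelFamily (opGeo g X blk) (coeffBg₁ J π g.M θ) from
    opFamily (g := g) (B := coeffBg₁ J π g.M θ) blk (blk ∘ π) (bgOps₁4 π ν G S D₃ D SD G' S' D₃' D' SD')

variable {G S D₃ : (X → ℝ) →ₗ[ℝ] (X → ℝ)} {D SD : J → (X → ℝ) →ₗ[ℝ] (X → ℝ)} {G' S' D₃' : (X' → ℝ) →ₗ[ℝ] (X' → ℝ)}
  {D' SD' : J → (X' → ℝ) →ₗ[ℝ] (X' → ℝ)}

/-- **`EtaRateIneq342` PER INDEX, FIRST-ORDER SPECIES, ALL FOUR ENTRIES CONSTRUCTED, EXPLICIT CONSTANTS** (`B₀ = bgConst(…) + bgConst1(…)`, `δ₀ = δ − σ`).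
[cite: Balaban1985BackgroundPropagators, Thm 3.1 (3.42) p.397 (shape, quantifier template)] -/
theorem etaRateIneq342_background₁4 (htri : Triangle254 g) (hd : ∀ a b : g.Site, 0 ≤ g.dist a b) {σ cr : ℝ} (hσ : 0 ≤ σ) (hcr : 0 ≤ cr)
    (hrow : RowSum g σ cr) (hη : 0 < g.eta) (hL : 0 < g.L) (hlen : ∀ y, 1 ≤ g.len y) {δ β m₀ θ c35 a₀ M α₀ γ : ℝ}
    (hσδ : σ ≤ δ) (hβ : 0 ≤ β) (hm₀ : 0 ≤ m₀) (hθ : 0 ≤ θ) (hθγ : ∀ y, θ ≤ rateWeight g γ y) (hc35 : 0 < c35) (ha₀ : 0 ≤ a₀)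
    (hq : β * (c35 * (1 + Fintype.card J) * a₀) * cr ≤ 1 / 2) (hM : 1 ≤ M) (hα₀ : 0 < α₀) (hMα : M * α₀ ≤ a₀) {ν : J}
    (hG : HasMaj (BlockNorm.ofBlocks g blk) (BlockNorm.ofBlocks g blk) G (fun y y' => β * Real.exp (-(δ * g.dist y y'))))
    (hD : ∀ μ, HasMaj (BlockNorm.ofBlocks g blk) (BlockNorm.ofBlocks g blk) (D μ) (fun y y' => β * Real.exp (-(δ * g.dist y y'))))
    (hG' : HasMaj (BlockNorm.ofBlocks g (blk ∘ π)) (BlockNorm.ofBlocks g (blk ∘ π)) G' (fun y y' => β * Real.exp (-(δ * g.dist y y'))))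
    (hD' : ∀ μ, HasMaj (BlockNorm.ofBlocks g (blk ∘ π)) (BlockNorm.ofBlocks g (blk ∘ π)) (D' μ) (fun y y' => β * Real.exp (-(δ * g.dist y y'))))
    (hS : HasMaj (BlockNorm.ofBlocks g blk) (BlockNorm.ofBlocks g blk) S (fun y y' => β * Real.exp (-(δ * g.dist y y'))))
    (hSD : ∀ μ, HasMaj (BlockNorm.ofBlocks g blk) (BlockNorm.ofBlocks g blk) (SD μ) (fun y y' => β * Real.exp (-(δ * g.dist y y'))))
    (hD₃' : HasMaj (BlockNorm.ofBlocks g (blk ∘ π)) (BlockNorm.ofBlocks g (blk ∘ π)) D₃' (fun y y' => β * Real.exp (-(δ * g.dist y y'))))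
    (hDG : HasMaj (BlockNorm.ofBlocks g blk) (BlockNorm.ofBlocks g (blk ∘ π)) (idef (pull π) (pull π) G' G)
      (fun y y' => m₀ * θ * Real.exp (-(δ * g.dist y y'))))
    (hDD : ∀ μ, HasMaj (BlockNorm.ofBlocks g blk) (BlockNorm.ofBlocks g (blk ∘ π)) (idef (pull π) (pull π) (D' μ) (D μ))
      (fun y y' => m₀ * θ * Real.exp (-(δ * g.dist y y'))))
    (hDS : HasMaj (BlockNorm.ofBlocks g blk) (BlockNorm.ofBlocks g (blk ∘ π)) (idef (pull π) (pull π) S' S)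
      (fun y y' => m₀ * θ * Real.exp (-(δ * g.dist y y'))))
    (hDSD : ∀ μ, HasMaj (BlockNorm.ofBlocks g blk) (BlockNorm.ofBlocks g (blk ∘ π)) (idef (pull π) (pull π) (SD' μ) (SD μ))
      (fun y y' => m₀ * θ * Real.exp (-(δ * g.dist y y'))))
    (hDD₃ : HasMaj (BlockNorm.ofBlocks g blk) (BlockNorm.ofBlocks g (blk ∘ π)) (idef (pull π) (pull π) D₃' D₃)
      (fun y y' => m₀ * θ * Real.exp (-(δ * g.dist y y'))))
    {U : (X' → ℝ) × (J → X' → ℝ)} (hreg : (coeffBg₁ J π M θ).Reg335 c35 α₀ U) :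
    EtaRateIneq342 (opFamily (g := g) (B := coeffBg₁ J π M θ) blk (blk ∘ π) (bgOps₁4 π ν G S D₃ D SD G' S' D₃' D' SD'))
      (bgConst β cr m₀ (c35 * (1 + Fintype.card J)) a₀ + bgConst1 β cr m₀ (c35 * (1 + Fintype.card J)) a₀) (δ - σ) γ U := by
  have hJ0 : (0 : ℝ) ≤ 1 + Fintype.card J := by positivity
  have hc35J : 0 ≤ c35 * (1 + Fintype.card J) := mul_nonneg hc35.le hJ0
  have h01 := hasMaj_entry01_background₁ blk π htri hd hσ hcr hrow hσδ hβ hm₀ hθ hc35 hq hM hα₀ hMα hG hD hG' hD' hDG hDD hreg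
  have h2 := hasMaj_entry2_background₁ blk π htri hd hσ hcr hrow hσδ hβ hm₀ hθ hc35 hq hM hα₀ hMα hG hD hG' hD' hS hSD hDG hDD hDS hDSD hreg
  have h3 := hasMaj_entry3_background₁ blk π htri hd hσ hcr hrow hσδ hβ hm₀ hθ hc35 ha₀ hq hM hα₀ hMα hG hD hG' hD' hD₃' hDG hDD hDD₃ hreg
  have hC0 : 0 ≤ bgConst β cr m₀ (c35 * (1 + Fintype.card J)) a₀ := bgConst_nonneg hβ hcr hm₀ hc35J ha₀
  have hC1 : 0 ≤ bgConst1 β cr m₀ (c35 * (1 + Fintype.card J)) a₀ := bgConst1_nonneg hβ hcr hm₀ hc35J ha₀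
  have hB₀ : 0 ≤ bgConst β cr m₀ (c35 * (1 + Fintype.card J)) a₀ + bgConst1 β cr m₀ (c35 * (1 + Fintype.card J)) a₀ := add_nonneg hC0 hC1
  refine etaRateIneq342_of_hasMaj (g := g) (B := coeffBg₁ J π M θ) blk (blk ∘ π) hη.le hL.le hB₀ (bgOps₁4 π ν G S D₃ D SD G' S' D₃' D' SD') U fun n => ?_
  have hdom : ∀ {B : ℝ}, 0 ≤ B → B ≤ bgConst β cr m₀ (c35 * (1 + Fintype.card J)) a₀ + bgConst1 β cr m₀ (c35 * (1 + Fintype.card J)) a₀ → ∀ y y' : g.Site,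
      B * θ * Real.exp (-((δ - σ) * g.dist y y')) ≤
        (bgConst β cr m₀ (c35 * (1 + Fintype.card J)) a₀ + bgConst1 β cr m₀ (c35 * (1 + Fintype.card J)) a₀) * B9.pref4 ((opGeo g X blk).len y) n *
          Real.exp (-((δ - σ) * g.dist y y')) * max (rateFactor (opGeo g X blk) γ y) (rateFactor (opGeo g X blk) γ y') := by
    intro B hB0 hB y y'
    have hpref : 1 ≤ B9.pref4 ((opGeo g X blk).len y) n := by rw [opGeo_len]; exact one_le_pref4 (hlen y) n
    have hrf : θ ≤ max (rateFactor (opGeo g X blk) γ y) (rateFactor (opGeo g X blk) γ y') := by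
      rw [rateFactor_opGeo g X blk hη.ne' hL γ y']
      exact (hθγ y').trans (le_max_right _ _)
    have hE : 0 ≤ Real.exp (-((δ - σ) * g.dist y y')) := Real.exp_nonneg _
    calc B * θ * Real.exp (-((δ - σ) * g.dist y y'))
        ≤ ((bgConst β cr m₀ (c35 * (1 + Fintype.card J)) a₀ + bgConst1 β cr m₀ (c35 * (1 + Fintype.card J)) a₀) *
            B9.pref4 ((opGeo g X blk).len y) n) * θ * Real.exp (-((δ - σ) * g.dist y y')) := by
          refine mul_le_mul_of_nonneg_right (mul_le_mul_of_nonneg_right ?_ hθ) hE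
          calc B = B * 1 := (mul_one B).symm
            _ ≤ _ := mul_le_mul hB hpref zero_le_one hB₀
      _ = (bgConst β cr m₀ (c35 * (1 + Fintype.card J)) a₀ + bgConst1 β cr m₀ (c35 * (1 + Fintype.card J)) a₀) *
            B9.pref4 ((opGeo g X blk).len y) n * Real.exp (-((δ - σ) * g.dist y y')) * θ := by ring
      _ ≤ _ := mul_le_mul_of_nonneg_left hrf (mul_nonneg (mul_nonneg hB₀ (zero_le_one.trans hpref)) hE)
  fin_cases n
  · exact (h01 none).mono (hdom hC0 (le_add_of_nonneg_right hC1))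
  · exact (h01 (some ν)).mono (hdom hC0 (le_add_of_nonneg_right hC1))
  · have h2p := hasMaj_projO_comp (blk ∘ π) h2 none
    have hcomp : idef (pull π) (pull π) (projO none ∘ₗ bgSourceV (stack G' D') (stack S' SD') (unstack U.1 U.2))
        (projO none ∘ₗ bgSourceV (stack G D) (stack S SD) (unstack (avg₁ J π U).1 (avg₁ J π U).2)) =
        projO none ∘ₗ idef (pull π) (pull (liftPair π)) (bgSourceV (stack G' D') (stack S' SD') (unstack U.1 U.2))
          (bgSourceV (stack G D) (stack S SD) (unstack (avg₁ J π U).1 (avg₁ J π U).2)) :=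
      LinearMap.ext fun v => funext fun x' => rfl
    have h2' := (show HasMaj (BlockNorm.ofBlocks g blk) (BlockNorm.ofBlocks g (blk ∘ π)) _ _ from hcomp ▸ h2p)
    exact h2'.mono (hdom hC0 (le_add_of_nonneg_right hC1))
  · exact h3.mono (hdom hC1 (le_add_of_nonneg_left hC0))

end Readout

section Node

variable {I J : Type} [Fintype J] [DecidableEq J] (g : I → B6.Geometry) (X X' : I → Type) [∀ i, Fintype (X i)] [∀ i, Fintype (X' i)]
  [∀ i, DecidableEq (X i)] [∀ i, DecidableEq (X' i)] (blk : ∀ i, X i → (g i).Site) (π : ∀ i, X' i → X i) (nsh : I → ℕ) (hL0 : ∀ i, (g i).L ≠ 0)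
  (θc θ : I → ℝ) (ν : I → J) (G S D₃ : ∀ i, (X i → ℝ) →ₗ[ℝ] (X i → ℝ)) (D SD : ∀ i, J → (X i → ℝ) →ₗ[ℝ] (X i → ℝ))
  (G' S' D₃' : ∀ i, (X' i → ℝ) →ₗ[ℝ] (X' i → ℝ)) (D' SD' : ∀ i, J → (X' i → ℝ) →ₗ[ℝ] (X' i → ℝ))

/-- **NE2⁺, OPERATOR LAYER — `T4EtaRate.NE2PlusOperator` BY NAME, FIRST-ORDER SPECIES, ALL FOUR ENTRIES CONSTRUCTED, ONLY THE `U ≡ 1` LAYER DISPLAYED.**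
For ANY family with UNIFORM `U ≡ 1` letters — majorants `β·e^{−δd}` (`σ < δ`) of `G_i, (∇_μG)_i, (G∇*)_i, (∇_μG∇*)_i` (coarse) and `G′_i, (∇′_μG′)_i, (Δ′G′)_i`
(fine); η-defects `m₀·θ_i·e^{−δd}` of the five pairs; `0 ≤ θ_i ≤ (L^j)^{−γ}`, `γ > 0`; carriers with (2.54), `d ≥ 0`, uniform (2.61), `η, L > 0`, sites of size
`≥ 1`; `c₃₅ > 0` —: `NE2PlusOperator c₃₅ (bgInstance₁ …) (bgFamily₁4 …)`, `M₅ = 1`, `a₀ = (2c₃₅(1+|J|)(βc_r+1))⁻¹`, `B₀ = bgConst(…) + bgConst1(…) + 1`, `δ₀ = δ − σ`;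
(3.35) CONSUMED on every coefficient of `V = M_c + Σ_μ M_{a_μ}∘∇_μ`. [cite: Balaban1985BackgroundPropagators, Thm 3.1 p.397 (quantifier template); (3.35) p.396, (3.42) + (3.44) p.397, (3.52) p.400, (3.63)–(3.65) pp.402–403 (shapes, mechanism)] -/
theorem ne2PlusOperator_background₁4 (c35 : ℝ) (hc35 : 0 < c35)
    (htri : ∀ i, Triangle254 (g i)) (hd : ∀ i (a b : (g i).Site), 0 ≤ (g i).dist a b) {σ cr : ℝ} (hσ : 0 ≤ σ) (hcr : 0 ≤ cr)
    (hrow : ∀ i, RowSum (g i) σ cr) (hη : ∀ i, 0 < (g i).eta) (hL : ∀ i, 0 < (g i).L) (hlen : ∀ i y, 1 ≤ (g i).len y)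
    {δ β m₀ γ : ℝ} (hσδ : σ < δ) (hβ : 0 ≤ β) (hm₀ : 0 ≤ m₀) (hγ : 0 < γ) (hθ : ∀ i, 0 ≤ θ i) (hθγ : ∀ i y, θ i ≤ rateWeight (g i) γ y)
    (hG : ∀ i, HasMaj (BlockNorm.ofBlocks (g i) (blk i)) (BlockNorm.ofBlocks (g i) (blk i)) (G i) (fun y y' => β * Real.exp (-(δ * (g i).dist y y'))))
    (hD : ∀ i μ, HasMaj (BlockNorm.ofBlocks (g i) (blk i)) (BlockNorm.ofBlocks (g i) (blk i)) (D i μ)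
      (fun y y' => β * Real.exp (-(δ * (g i).dist y y'))))
    (hG' : ∀ i, HasMaj (BlockNorm.ofBlocks (g i) (blk i ∘ π i)) (BlockNorm.ofBlocks (g i) (blk i ∘ π i)) (G' i)
      (fun y y' => β * Real.exp (-(δ * (g i).dist y y'))))
    (hD' : ∀ i μ, HasMaj (BlockNorm.ofBlocks (g i) (blk i ∘ π i)) (BlockNorm.ofBlocks (g i) (blk i ∘ π i)) (D' i μ)
      (fun y y' => β * Real.exp (-(δ * (g i).dist y y'))))
    (hS : ∀ i, HasMaj (BlockNorm.ofBlocks (g i) (blk i)) (BlockNorm.ofBlocks (g i) (blk i)) (S i) (fun y y' => β * Real.exp (-(δ * (g i).dist y y'))))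
    (hSD : ∀ i μ, HasMaj (BlockNorm.ofBlocks (g i) (blk i)) (BlockNorm.ofBlocks (g i) (blk i)) (SD i μ)
      (fun y y' => β * Real.exp (-(δ * (g i).dist y y'))))
    (hD₃' : ∀ i, HasMaj (BlockNorm.ofBlocks (g i) (blk i ∘ π i)) (BlockNorm.ofBlocks (g i) (blk i ∘ π i)) (D₃' i)
      (fun y y' => β * Real.exp (-(δ * (g i).dist y y'))))
    (hDG : ∀ i, HasMaj (BlockNorm.ofBlocks (g i) (blk i)) (BlockNorm.ofBlocks (g i) (blk i ∘ π i)) (idef (pull (π i)) (pull (π i)) (G' i) (G i))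
      (fun y y' => m₀ * θ i * Real.exp (-(δ * (g i).dist y y'))))
    (hDD : ∀ i μ, HasMaj (BlockNorm.ofBlocks (g i) (blk i)) (BlockNorm.ofBlocks (g i) (blk i ∘ π i))
      (idef (pull (π i)) (pull (π i)) (D' i μ) (D i μ)) (fun y y' => m₀ * θ i * Real.exp (-(δ * (g i).dist y y'))))
    (hDS : ∀ i, HasMaj (BlockNorm.ofBlocks (g i) (blk i)) (BlockNorm.ofBlocks (g i) (blk i ∘ π i)) (idef (pull (π i)) (pull (π i)) (S' i) (S i))
      (fun y y' => m₀ * θ i * Real.exp (-(δ * (g i).dist y y'))))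
    (hDSD : ∀ i μ, HasMaj (BlockNorm.ofBlocks (g i) (blk i)) (BlockNorm.ofBlocks (g i) (blk i ∘ π i))
      (idef (pull (π i)) (pull (π i)) (SD' i μ) (SD i μ)) (fun y y' => m₀ * θ i * Real.exp (-(δ * (g i).dist y y'))))
    (hDD₃ : ∀ i, HasMaj (BlockNorm.ofBlocks (g i) (blk i)) (BlockNorm.ofBlocks (g i) (blk i ∘ π i)) (idef (pull (π i)) (pull (π i)) (D₃' i) (D₃ i))
      (fun y y' => m₀ * θ i * Real.exp (-(δ * (g i).dist y y')))) :
    NE2PlusOperator c35 (fun i => bgInstance₁ J (blk i) (π i) (nsh i) (hL0 i) (θc i) (θ i))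
      (fun i => bgFamily₁4 (blk i) (π i) (nsh i) (hL0 i) (θc i) (θ i) (ν i) (G i) (S i) (D₃ i) (D i) (SD i) (G' i) (S' i) (D₃' i) (D' i) (SD' i)) := by
  have hJ0 : (0 : ℝ) < 1 + Fintype.card J := by positivity
  set a₀ : ℝ := (2 * (c35 * (1 + Fintype.card J)) * (β * cr + 1))⁻¹ with ha₀_def
  have hden : 0 < 2 * (c35 * (1 + Fintype.card J)) * (β * cr + 1) := by positivity
  have ha₀ : 0 < a₀ := inv_pos.2 hden
  have hq : β * (c35 * (1 + Fintype.card J) * a₀) * cr ≤ 1 / 2 := by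
    have h1 : β * (c35 * (1 + Fintype.card J) * a₀) * cr = (β * cr) * (c35 * (1 + Fintype.card J) * a₀) := by ring
    have h2 : c35 * (1 + Fintype.card J) * a₀ = (2 * (β * cr + 1))⁻¹ := by
      rw [ha₀_def]; field_simp
    rw [h1, h2, ← div_eq_mul_inv, div_le_iff₀ (by positivity)]
    nlinarith [mul_nonneg hβ hcr]
  have hc35J : 0 ≤ c35 * (1 + Fintype.card J) := mul_nonneg hc35.le hJ0.le
  have hC0 : 0 ≤ bgConst β cr m₀ (c35 * (1 + Fintype.card J)) a₀ := bgConst_nonneg hβ hcr hm₀ hc35J ha₀.le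
  have hC1 : 0 ≤ bgConst1 β cr m₀ (c35 * (1 + Fintype.card J)) a₀ := bgConst1_nonneg hβ hcr hm₀ hc35J ha₀.le
  refine ⟨1, δ - σ, a₀, bgConst β cr m₀ (c35 * (1 + Fintype.card J)) a₀ + bgConst1 β cr m₀ (c35 * (1 + Fintype.card J)) a₀ + 1, γ, one_pos,
    by linarith, ha₀, by linarith, hγ, fun i hM α₀ hα₀ hMα U hreg => ?_⟩
  have hM' : 1 ≤ (g i).M := hM
  have hMα' : (g i).M * α₀ ≤ a₀ := hMα
  have key := etaRateIneq342_background₁4 (J := J) (blk i) (π i) (htri i) (hd i) hσ hcr (hrow i) (hη i) (hL i) (hlen i) hσδ.le hβ hm₀ (hθ i)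
    (hθγ i) hc35 ha₀.le hq hM' hα₀ hMα' (ν := ν i) (hG i) (hD i) (hG' i) (hD' i) (hS i) (hSD i) (hD₃' i) (hDG i) (hDD i) (hDS i) (hDSD i) (hDD₃ i)
    hreg
  intro n lam y y' hs
  refine (key n lam y y' hs).trans ?_
  have hpref : 0 ≤ B9.pref4 ((bgInstance₁ J (blk i) (π i) (nsh i) (hL0 i) (θc i) (θ i)).gc.len y) n := by
    have : 1 ≤ B9.pref4 ((opGeo (g i) (X i) (blk i)).len y) n := by rw [opGeo_len]; exact one_le_pref4 (hlen i y) n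
    exact zero_le_one.trans this
  have hrf : 0 ≤ max (rateFactor (bgInstance₁ J (blk i) (π i) (nsh i) (hL0 i) (θc i) (θ i)).gc γ y)
      (rateFactor (bgInstance₁ J (blk i) (π i) (nsh i) (hL0 i) (θc i) (θ i)).gc γ y') :=
    (T4EtaRate.rateFactor_nonneg (g := opGeo (g i) (X i) (blk i)) (hη i).le (hL i).le γ y).trans (le_max_left _ _)
  have hnorm : 0 ≤ (bgInstance₁ J (blk i) (π i) (nsh i) (hL0 i) (θc i) (θ i)).gc.supNorm lam := Real.iSup_nonneg fun x => abs_nonneg _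
  have hE : 0 ≤ Real.exp (-((δ - σ) * (bgInstance₁ J (blk i) (π i) (nsh i) (hL0 i) (θc i) (θ i)).gc.dist y y')) := Real.exp_nonneg _
  exact mul_le_mul_of_nonneg_right (mul_le_mul_of_nonneg_right (mul_le_mul_of_nonneg_right
    (mul_le_mul_of_nonneg_right (le_add_of_nonneg_right zero_le_one) hpref) hE) hrf) hnorm

end Node

end Summit.QuantumFields.YangMills.BalabanUVNodes.N15.BackgroundLayer
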